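import Summits.AtomisticToContinuum.Crystallization.Theorems.PalmUnimodularRigidityLayeredLawsSelectHcpPathVariance

/-!
# A discrete arc–chord inequality in `ℝ³`
(stubs `tube_arcChord`, `tube_arcChord_of_secondDiff` of line `mtp-prestress-split-ergodic-frame`,
crux `LayeredLawsSelectHcp`, stmt-AtomisticToContinuum-9226)

A chain of `n` vectors ("bonds") `b₀, …, b_{n-1}`, each of length `≥ ℓ`, whose pairwise
differences grow at most linearly, `‖bᵢ − bⱼ‖ ≤ κ |i − j|`, has a long resultant:
`‖∑ bᵢ‖² ≥ n² ℓ² − κ² · n²(n² − 1)/12` (`tube_arcChord`). This is the landed path-variance identity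
`tube_pathVariance` (`‖∑ vᵢ‖² = n ∑ ‖vᵢ‖² − ∑_{i<j} ‖vᵢ − vⱼ‖²`) together with the closed form
`∑_{i<j<n} (j − i)² = n²(n² − 1)/12` (`arcChord_sum_sum_fin`). The companion
`tube_arcChord_of_secondDiff` is the version for a discrete path `p : ℕ → ℝ³` with bonds
`bₜ = p (t+1) − p t` of length `≥ ℓ` and second differences `‖p (t+1) − 2 p t + p (t−1)‖ ≤ κ`:
telescoping gives `p n − p 0 = ∑ bₜ`, and the triangle inequality along consecutive second
differences gives `‖bᵢ − bⱼ‖ ≤ κ |i − j|` (`arcChord_pair_bound`). All `[folklore]`.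
-/

noncomputable section

namespace Summit.AtomisticToContinuum.Crystallization.Theorems.PalmUnimodularRigidity.LayeredLawsSelectHcp

open Finset

/-- `∑_{i<n} (c − i)² = n c² − c n (n − 1) + (n − 1) n (2n − 1)/6`. [folklore] -/
theorem arcChord_sum_range_sq_sub (c : ℝ) : ∀ n : ℕ,
    ∑ i ∈ range n, (c - i) ^ 2 =
      n * c ^ 2 - c * (n * ((n : ℝ) - 1)) + ((n : ℝ) - 1) * n * (2 * n - 1) / 6
  | 0 => by simp
  | n + 1 => by
    rw [sum_range_succ, arcChord_sum_range_sq_sub c n]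
    push_cast
    ring

/-- `∑_{i<n} ∑_{j<n} [i<j] (j − i)² = n²(n² − 1)/12` (range version). [folklore] -/
theorem arcChord_sum_sum_range : ∀ n : ℕ,
    ∑ i ∈ range n, ∑ j ∈ range n, (if i < j then ((j : ℝ) - i) ^ 2 else (0 : ℝ)) =
      (n : ℝ) ^ 2 * ((n : ℝ) ^ 2 - 1) / 12
  | 0 => by simp
  | n + 1 => by
    rw [sum_range_succ]
    simp_rw [sum_range_succ]
    have h1 : ∑ i ∈ range n, (if i < n then ((n : ℝ) - i) ^ 2 else (0 : ℝ)) =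
        ∑ i ∈ range n, ((n : ℝ) - i) ^ 2 :=
      sum_congr rfl fun i hi => if_pos (mem_range.1 hi)
    have h2 : ∑ j ∈ range n, (if n < j then ((j : ℝ) - n) ^ 2 else (0 : ℝ)) = 0 :=
      sum_eq_zero fun j hj => if_neg (not_lt.2 (mem_range.1 hj).le)
    rw [sum_add_distrib, arcChord_sum_sum_range n, h1, h2, if_neg (lt_irrefl n),
      arcChord_sum_range_sq_sub (n : ℝ) n]
    push_cast
    ring

/-- `∑ᵢ ∑ⱼ [i<j] (j − i)² = n²(n² − 1)/12` over `Fin n`. [folklore] -/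
theorem arcChord_sum_sum_fin (n : ℕ) :
    ∑ i : Fin n, ∑ j : Fin n, (if i < j then (((j : ℕ) : ℝ) - ((i : ℕ) : ℝ)) ^ 2 else (0 : ℝ)) =
      (n : ℝ) ^ 2 * ((n : ℝ) ^ 2 - 1) / 12 := by
  calc ∑ i : Fin n, ∑ j : Fin n, (if i < j then (((j : ℕ) : ℝ) - ((i : ℕ) : ℝ)) ^ 2 else (0 : ℝ))
      = ∑ i : Fin n, ∑ j ∈ range n,
          (if (i : ℕ) < j then ((j : ℝ) - ((i : ℕ) : ℝ)) ^ 2 else (0 : ℝ)) := by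
        refine sum_congr rfl fun i _ => ?_
        exact Fin.sum_univ_eq_sum_range
          (fun j => if (i : ℕ) < j then ((j : ℝ) - ((i : ℕ) : ℝ)) ^ 2 else (0 : ℝ)) n
    _ = ∑ i ∈ range n, ∑ j ∈ range n, (if i < j then ((j : ℝ) - i) ^ 2 else (0 : ℝ)) :=
        Fin.sum_univ_eq_sum_range
          (fun i => ∑ j ∈ range n, if i < j then ((j : ℝ) - i) ^ 2 else (0 : ℝ)) n
    _ = (n : ℝ) ^ 2 * ((n : ℝ) ^ 2 - 1) / 12 := arcChord_sum_sum_range n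

/-- Chain bound: if consecutive terms of `c` differ by at most `κ` below `n`, then
`‖c (s + k) − c s‖ ≤ κ k` for `s + k < n`. [folklore] -/
theorem arcChord_chain_bound {E : Type*} [SeminormedAddCommGroup E] (c : ℕ → E) (κ : ℝ) (n : ℕ)
    (h : ∀ t, 0 < t → t < n → ‖c t - c (t - 1)‖ ≤ κ) :
    ∀ s k : ℕ, s + k < n → ‖c (s + k) - c s‖ ≤ κ * k := by
  intro s k
  induction k with
  | zero => intro _; simp
  | succ k ih =>
    intro hsk
    have h1 : ‖c (s + k) - c s‖ ≤ κ * k := ih (by omega)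
    have h2 : ‖c (s + k + 1) - c (s + k)‖ ≤ κ := by
      have := h (s + k + 1) (Nat.succ_pos _) (by omega)
      simpa using this
    calc ‖c (s + (k + 1)) - c s‖ = ‖(c (s + k + 1) - c (s + k)) + (c (s + k) - c s)‖ := by
          rw [sub_add_sub_cancel, ← add_assoc]
      _ ≤ ‖c (s + k + 1) - c (s + k)‖ + ‖c (s + k) - c s‖ := norm_add_le _ _
      _ ≤ κ + κ * k := add_le_add h2 h1
      _ = κ * ((k + 1 : ℕ) : ℝ) := by push_cast; ring

/-- Pair bound: if consecutive terms of `c` differ by at most `κ` below `n`, then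
`‖c i − c j‖ ≤ κ |i − j|` for `i, j < n`. [folklore] -/
theorem arcChord_pair_bound {E : Type*} [SeminormedAddCommGroup E] (c : ℕ → E) (κ : ℝ) (n : ℕ)
    (h : ∀ t, 0 < t → t < n → ‖c t - c (t - 1)‖ ≤ κ) :
    ∀ i j : ℕ, i < n → j < n → ‖c i - c j‖ ≤ κ * |(i : ℝ) - (j : ℝ)| := by
  have key : ∀ i j : ℕ, i ≤ j → j < n → ‖c j - c i‖ ≤ κ * |(i : ℝ) - (j : ℝ)| := by
    intro i j hij hj
    obtain ⟨k, rfl⟩ := Nat.exists_eq_add_of_le hij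
    have habs : |(i : ℝ) - ((i + k : ℕ) : ℝ)| = k := by
      push_cast
      rw [show (i : ℝ) - ((i : ℝ) + k) = -(k : ℝ) by ring, abs_neg, Nat.abs_cast]
    rw [habs]
    exact arcChord_chain_bound c κ n h i k hj
  intro i j hi hj
  rcases le_total i j with hij | hji
  · rw [norm_sub_rev]
    exact key i j hij hj
  · rw [abs_sub_comm]
    exact key j i hji hi

/-- **Arc–chord inequality (stub `tube_arcChord`).** A chain of `n` bonds `b : Fin n → ℝ³`, each of
length `≥ ℓ`, with `‖bᵢ − bⱼ‖ ≤ κ |i − j|`, has `‖∑ bᵢ‖² ≥ n² ℓ² − κ² n²(n² − 1)/12`. [folklore] -/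
theorem tube_arcChord : ∀ (n : ℕ) (b : Fin n → EuclideanSpace ℝ (Fin 3)) (ℓ κ : ℝ), 0 ≤ ℓ →
    (∀ i, ℓ ≤ ‖b i‖) → (∀ i j : Fin n, ‖b i - b j‖ ≤ κ * |((i : ℕ) : ℝ) - ((j : ℕ) : ℝ)|) →
    (n : ℝ) ^ 2 * ℓ ^ 2 - κ ^ 2 * ((n : ℝ) ^ 2 * ((n : ℝ) ^ 2 - 1) / 12) ≤ ‖∑ i, b i‖ ^ 2 := by
  intro n b ℓ κ hℓ hb hκ
  rw [tube_pathVariance n b]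
  have h1 : (n : ℝ) * ℓ ^ 2 ≤ ∑ i, ‖b i‖ ^ 2 := by
    have : ∑ _i : Fin n, ℓ ^ 2 ≤ ∑ i, ‖b i‖ ^ 2 :=
      sum_le_sum fun i _ => pow_le_pow_left₀ hℓ (hb i) 2
    simpa [sum_const, card_univ, Fintype.card_fin, nsmul_eq_mul] using this
  have h2 : (∑ i, ∑ j, if i < j then ‖b i - b j‖ ^ 2 else (0 : ℝ)) ≤
      κ ^ 2 * ((n : ℝ) ^ 2 * ((n : ℝ) ^ 2 - 1) / 12) := by
    rw [← arcChord_sum_sum_fin n, mul_sum]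
    refine sum_le_sum fun i _ => ?_
    rw [mul_sum]
    refine sum_le_sum fun j _ => ?_
    split_ifs with hij
    · calc ‖b i - b j‖ ^ 2 ≤ (κ * |((i : ℕ) : ℝ) - ((j : ℕ) : ℝ)|) ^ 2 :=
            pow_le_pow_left₀ (norm_nonneg _) (hκ i j) 2
        _ = κ ^ 2 * (((j : ℕ) : ℝ) - ((i : ℕ) : ℝ)) ^ 2 := by rw [mul_pow, sq_abs]; ring
    · simp
  have h3 : (n : ℝ) * ((n : ℝ) * ℓ ^ 2) ≤ (n : ℝ) * ∑ i, ‖b i‖ ^ 2 :=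
    mul_le_mul_of_nonneg_left h1 (Nat.cast_nonneg n)
  nlinarith [h2, h3]

/-- **Arc–chord inequality for a discrete path (stub `tube_arcChord_of_secondDiff`).** If the bonds
`p (t+1) − p t`, `t < n`, have length `≥ ℓ` and the second differences
`‖p (t+1) − 2 p t + p (t−1)‖`, `0 < t < n`, are `≤ κ`, then
`‖p n − p 0‖² ≥ n² ℓ² − κ² n²(n² − 1)/12`. [folklore] -/
theorem tube_arcChord_of_secondDiff : ∀ (n : ℕ) (p : ℕ → EuclideanSpace ℝ (Fin 3)) (ℓ κ : ℝ),
    0 ≤ ℓ → 0 ≤ κ → (∀ t, t < n → ℓ ≤ ‖p (t + 1) - p t‖) →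
    (∀ t, 0 < t → t < n → ‖p (t + 1) - (2 : ℝ) • p t + p (t - 1)‖ ≤ κ) →
    (n : ℝ) ^ 2 * ℓ ^ 2 - κ ^ 2 * ((n : ℝ) ^ 2 * ((n : ℝ) ^ 2 - 1) / 12) ≤ ‖p n - p 0‖ ^ 2 := by
  intro n p ℓ κ hℓ _ hb hdd
  have htel : ∑ i : Fin n, (p ((i : ℕ) + 1) - p i) = p n - p 0 :=
    (Fin.sum_univ_eq_sum_range (fun t => p (t + 1) - p t) n).trans (sum_range_sub p n)
  have hc : ∀ t, 0 < t → t < n → ‖(p (t + 1) - p t) - (p (t - 1 + 1) - p (t - 1))‖ ≤ κ := by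
    intro t ht htn
    have e : (p (t + 1) - p t) - (p (t - 1 + 1) - p (t - 1)) =
        p (t + 1) - (2 : ℝ) • p t + p (t - 1) := by
      rw [Nat.sub_add_cancel ht, two_smul]
      abel
    rw [e]
    exact hdd t ht htn
  rw [← htel]
  exact tube_arcChord n (fun i => p ((i : ℕ) + 1) - p i) ℓ κ hℓ (fun i => hb i i.2)
    fun i j => arcChord_pair_bound (fun t => p (t + 1) - p t) κ n hc i j i.2 j.2

end Summit.AtomisticToContinuum.Crystallization.Theorems.PalmUnimodularRigidity.LayeredLawsSelectHcp
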